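import Literature.AlgebraicGeometry.HodgeTheory.PicardLefschetzNodalForms
import Literature.AlgebraicGeometry.HodgeTheory.PolarizationFormMonodromyInvariant
import Literature.AlgebraicGeometry.HodgeTheory.RelativeHyperplaneClassHodgeRiemann
import Literature.AlgebraicGeometry.HodgeTheory.VeryGeneralHypersurfaceHodgeConjecture
import Literature.AlgebraicGeometry.HodgeTheory.HolomorphicBundleChernCharacterProjectiveSpace
import HarnessLib

/-!
# A flat Picard–Lefschetz coefficient for the universal family of smooth hypersurfaces

Family `hodge`, layer `Literature/AlgebraicGeometry/HodgeTheory`; proof file (theorems only, no definition, no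
named fact). Written by the prover seat `hodge-nonav-prover-Bx` (g13, cell `hodge-nonav`) for crux K1-B
`VeryGeneralSignCommutatorsInHg` of the route `HodgeConjecture/SignSymmetricPowers` (stmt-HodgeConjecture-19716),
whose registered binder `stub_picardLefschetzNodal` is the named fact `picardLefschetz_nodalForms_uniform`
(`HodgeTheory/PicardLefschetzNodalForms`). That fact is the conjunction of (a) the EXISTENCE OF A FLAT NOWHERE-ZERO
COEFFICIENT `c : U(ℂ) → ℚ` (`IsFlatCoefficient`: `c(s) · tr_s(x ∪ y) = c(t) · tr_t(Tx ∪ Ty)` for every rational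
transport `T` of `Rⁿ π_* ℚ` along every path) and (b) the Picard–Lefschetz formula with that coefficient at every
nodal degeneration. This file PROVES (a) — "the intersection form of the fibres is flat: the monodromy preserves the
cup product and the orientation" (Voisin II §3.1.2 and §3.2.3; Deligne, Weil I (5.3)) — on the tree's carriers,
where `tr_s` is the light trace of `BettiUniverseAxioms` (the coordinate along an ARBITRARY basis vector of the line
`H²ⁿ(Y_s(ℂ); ℚ)`, so that only `c(s) · tr_s`, not `tr_s` itself, can be flat).

## The mathematics

For the universal family `π : 𝒴_U → U` of smooth hypersurfaces of degree `d ≥ 1` in `ℙⁿ⁺¹_ℂ`, `n ≥ 1`, fix a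
non-zero rational `θ ∈ H²(ℙⁿ⁺¹(ℂ); ℚ)`, `h_s = θ|_{Y_s}`, `ω_s := Lⁿ_{h_s}(1) = h_sⁿ ∈ H²ⁿ(Y_s(ℂ); ℚ)`. Then
`ω_s` is FLAT (transport is multiplicative `transportFun_cupProduct`, fixes `1` `transportFun_one`, carries
restrictions of global classes to restrictions `transportFun_map_fiberι`) and NON-ZERO (`Y_s ↪ ℙⁿ⁺¹` is a closed
immersion, so `Y_s` has a Kähler–rational datum with Kähler class `λ · (h_s ⊗ 1)`, `H²(ℙⁿ⁺¹(ℂ); ℂ) = ℂ θ`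
(`exists_kaehlerRationalDatum_eq_map`); hard Lefschetz makes `Lⁿ_{λ h_s} = λⁿ Lⁿ_{h_s}` injective on
`H⁰ ∋ 1 ≠ 0`). As `H²ⁿ(Y_s(ℂ); ℚ)` is a line (`finrank_rat_top`), `x ∪ y = q ω_s`, `q = tr_s(x ∪ y)/tr_s(ω_s)`,
and transporting `Tx ∪ Ty = q ω_t`: the coefficient `c(s) := tr_s(ω_s)⁻¹` is flat and nowhere zero. Results:
`exists_isFlatCoefficient` (conjunct (a) of `picardLefschetz_nodalForms_uniform`), its explicit form
`isFlatCoefficient_inv_tr_topPow`, the transport identity `tr_cup_ratTransport_mul_tr`, and the closure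
properties `IsFlatCoefficient.const_mul` / `IsFlatCoefficient.ratio_eq` (flat coefficients are unique up to a
constant wherever the form is non-zero). Nothing here says the Picard–Lefschetz formula (conjunct (b)) is proved.

## References

* [VoisinHodgeII2003] C. Voisin, Hodge Theory and Complex Algebraic Geometry II, CUP 2003, §3.1.2, §3.2.3, §6.2.1.
* [VoisinHodgeI2002] C. Voisin, Hodge Theory and Complex Algebraic Geometry I, CUP 2002, Thm. 6.25, §7.1.2, §9.2.1.
* [Deligne1974] P. Deligne, La conjecture de Weil. I, Publ. Math. IHÉS 43 (1974), (5.2.1), (5.3).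
* [HatcherAT2002] A. Hatcher, Algebraic Topology, CUP 2002, §3.2 Prop. 3.10, Thm. 3.19.
-/

noncomputable section

open CategoryTheory AlgebraicGeometry
open Literature.AlgebraicTopology.SingularHomology Literature.Geometry.Kaehler
open Literature.AlgebraicGeometry.Motives Literature.AlgebraicGeometry.Motives.UniversalHypersurface
open Literature.Topology.FourManifolds

namespace Literature.AlgebraicGeometry.HodgeTheory

section HodgeTheory

/-! ### Algebra on singular cohomology: units, scalars and the iterated Lefschetz operator -/

section Algebra

universe u

variable {Y : Type u} [TopologicalSpace Y]

/-- Change of coefficients `ℚ → ℂ` carries the unit class to the unit class (local copy of the tree's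
`CharacteristicClasses.ringChange_one`, kept here to keep the import cone small). [cite: HatcherAT2002, §3.2 p. 215] -/
private theorem ofRatClass_one_flatCoefficient :
    ofRatClass Y 0 (singularCohomology.one ℚ Y) = singularCohomology.one ℂ Y := by
  rw [ofRatClass_eq_ringChange, singularCohomology.one, singularCohomology.one, singularCohomology.ringChange_π]
  congr 1
  refine coFn_injective ?_
  rw [coFn_cocyclesRingChange, coFn_cocyclesMk, coFn_cocyclesMk]
  funext σ
  exact map_one (algebraMap ℚ ℂ)

/-- Complexification is multiplicative: `(a ∪ b) ⊗ 1 = (a ⊗ 1) ∪ (b ⊗ 1)` (the cup product is natural in the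
coefficient ring; local spelling of `ofRatClass_cupProduct`). [cite: HatcherAT2002, §3.2 p. 215] -/
private theorem ofRatClass_cupProduct_flatCoefficient {p q m : ℕ} (h : p + q = m) (a : singularCohomology ℚ ℚ Y p)
    (b : singularCohomology ℚ ℚ Y q) :
    ofRatClass Y m (cupProduct h a b) = cupProduct h (ofRatClass Y p a) (ofRatClass Y q b) := by
  rw [ofRatClass_eq_ringChange, ofRatClass_eq_ringChange, ofRatClass_eq_ringChange,
    singularCohomology.ringChange_cupProduct]

variable {R : Type} [CommRing R]

/-- **Homogeneity of the iterated Lefschetz operator in the class**: `Lʲ_{λκ} = λʲ Lʲ_κ`.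
[cite: VoisinHodgeI2002, §6.2.3] -/
theorem lefschetzPowTo_smul_class (κ : singularCohomology R R Y 2) (lam : R) :
    ∀ (t a m : ℕ) (h : a + 2 * t = m) (x : singularCohomology R R Y a),
      lefschetzPowTo (lam • κ) t a m h x = lam ^ t • lefschetzPowTo κ t a m h x
  | 0, a, m, h, x => by
    subst h
    rw [pow_zero, one_smul]
    rfl
  | t + 1, a, m, h, x => by
    rw [lefschetzPowTo_succ_apply (lam • κ) t a (a + 2 * t) m rfl h (by omega),
      lefschetzPowTo_succ_apply κ t a (a + 2 * t) m rfl h (by omega),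
      lefschetzPowTo_smul_class κ lam t a (a + 2 * t) rfl x, lefschetzOperator_apply, lefschetzOperator_apply,
      LinearMap.map_smul₂, map_smul, smul_smul, pow_succ']

/-- Change of coefficients `ℚ → ℂ` commutes with the iterated Lefschetz operators of `κ` and `κ ⊗ 1`.
[cite: VoisinHodgeI2002, §7.1.2] -/
theorem ofRatClass_lefschetzPowTo (κ : singularCohomology ℚ ℚ Y 2) (t a m : ℕ) (h : a + 2 * t = m)
    (x : singularCohomology ℚ ℚ Y a) :
    ofRatClass Y m (lefschetzPowTo κ t a m h x) = lefschetzPowTo (ofRatClass Y 2 κ) t a m h (ofRatClass Y a x) := by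
  rw [ofRatClass_eq_ringChange _ (lefschetzPowTo κ t a m h x), ofRatClass_eq_ringChange _ x,
    ringChange_lefschetzPowTo_of_eq (algebraMap ℚ ℂ) (ofRatClass_eq_ringChange 2 κ).symm t a m h x]

end Algebra

/-! ### Transport commutes with the iterated Lefschetz operator of a global class -/

section Family

variable {𝒳 S : Motives.SchemeOver ℂ} (f : 𝒳 ⟶ S) {U : Set (Motives.ComplexPoints S)}
  (hU : IsCohomologicallyLocallyTrivialOn f U)

/-- **Transport commutes with `Lʲ` of a GLOBAL class** `K ∈ H²(𝒳(ℂ); ℂ)`: for the restrictions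
`κ_s = K|_{X_s}`, `γ_* (Lʲ_{κ_s} x) = Lʲ_{κ_t} (γ_* x)` along every path `γ` from `s` to `t` (iterate
`transportFun_lefschetzOperator`; the two-point form of `map_lefschetzPowTo_of_commute`).
[cite: VoisinHodgeII2003, §3.1.2] -/
theorem transportFun_lefschetzPowTo (K : complexBetti 𝒳 2) {s t : U} (γ : Path.Homotopic.Quotient s t) :
    ∀ (j a m : ℕ) (h : a + 2 * j = m) (x : complexBetti (Motives.fiberOver f s.1) a),
      transportFun f m hU γ (lefschetzPowTo (complexBetti.map (Motives.fiberι f s.1) 2 K) j a m h x) =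
        lefschetzPowTo (complexBetti.map (Motives.fiberι f t.1) 2 K) j a m h (transportFun f a hU γ x)
  | 0, a, m, h, x => by
    subst h
    rfl
  | j + 1, a, m, h, x => by
    rw [lefschetzPowTo_succ_apply _ j a (a + 2 * j) m rfl h (by omega),
      lefschetzPowTo_succ_apply _ j a (a + 2 * j) m rfl h (by omega), transportFun_lefschetzOperator,
      transportFun_lefschetzPowTo K γ j a (a + 2 * j) rfl x]

end Family

/-! ### The flat top class `θ|ⁿ_{Y_s}` of the universal family -/

section UniversalFamily

variable {n d : ℕ}

/-- The degree equation `0 + 2n = n + n` of `Lⁿ : H⁰ → H^{n+n}` (private plumbing; any proof may be supplied by a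
consumer, by proof irrelevance). [folklore] -/
private theorem zero_add_two_mul_eq_add_self (n : ℕ) : 0 + 2 * n = n + n := by
  omega

/-- A non-zero rational class `θ ∈ H²(ℙᴺ(ℂ); ℚ)`, `N ≥ 1` (`dim_ℚ H²(ℂℙᴺ; ℚ) = 1`, Hatcher Thm. 3.19, transported
along `ℙᴺ_ℂ(ℂ) ≃ₜ ℂℙᴺ`). [cite: HatcherAT2002, Thm. 3.19] -/
theorem exists_bettiCohomology_projectiveSpace_two_ne_zero (N : ℕ) (hN : 1 ≤ N) :
    ∃ θ : bettiCohomology (projectiveSpace N ℂ) 2, θ ≠ 0 := by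
  have h2 := ComplexProjectiveSpace.finrank_singularCohomology_two_mul_eq_one ℚ N 1 hN
  rw [mul_one] at h2
  have h : Module.finrank ℚ (bettiCohomology (projectiveSpace N ℂ) 2) = 1 :=
    h2 ▸ (singularCohomology.mapIso ℚ ℚ (complexPointsProjectiveSpaceHomeomorph N) 2).toLinearEquiv.finrank_eq.symm
  haveI : Module.Finite ℚ (bettiCohomology (projectiveSpace N ℂ) 2) := Module.finite_of_finrank_eq_succ h
  exact Module.finrank_pos_iff_exists_ne_zero.1 (by rw [h]; exact one_pos)

/-- Every class of `H²(ℙᴺ(ℂ); ℂ)` is a complex multiple of `θ ⊗ 1` for a non-zero rational `θ`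
(`dim_ℂ H²(ℙᴺ(ℂ); ℂ) = 1`). [cite: HatcherAT2002, Thm. 3.19] -/
theorem exists_eq_smul_ofRatClass_projectiveSpace_two (N : ℕ) (hN : 1 ≤ N)
    {θ : bettiCohomology (projectiveSpace N ℂ) 2} (hθ : θ ≠ 0) (c : complexBetti (projectiveSpace N ℂ) 2) :
    ∃ lam : ℂ, c = lam • ofRatClass _ 2 θ := by
  have h1 : Module.finrank ℂ (complexBetti (projectiveSpace N ℂ) 2) = 1 := by
    have h := finrank_complexBetti_projectiveSpace_two_mul_eq_one N (p := 1) hN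
    rwa [mul_one] at h
  have hθC : ofRatClass _ 2 θ ≠ 0 := fun h ↦ hθ (ofRatClass_injective 2 (by rw [h, map_zero]))
  obtain ⟨lam, hlam⟩ := (finrank_eq_one_iff_of_nonzero' _ hθC).1 h1 c
  exact ⟨lam, hlam.symm⟩

variable (n d) in
/-- The restriction `h_s = θ|_{Y_s} ∈ H²(Y_s(ℂ); ℚ)` of `θ ∈ H²(ℙⁿ⁺¹(ℂ); ℚ)` to the fibre `Y_s ↪ 𝒴_U → ℙⁿ⁺¹`,
complexified, is the restriction to `Y_s` of the global class `(j^* θ) ⊗ 1 ∈ H²(𝒴_U(ℂ); ℂ)`.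
[cite: VoisinHodgeII2003, §6.2.1] -/
theorem ofRatClass_pull_fiberι_toProjectiveSpace (θ : bettiCohomology (projectiveSpace (n + 1) ℂ) 2)
    (s : ComplexPoints (base ℂ n d)) :
    ofRatClass (ComplexPoints (fiberOver (family ℂ n d) s)) 2
        (bettiCohomology.map (fiberι (family ℂ n d) s ≫ UniversalHypersurface.toProjectiveSpace ℂ n d) 2 θ) =
      complexBetti.map (fiberι (family ℂ n d) s) 2
        (complexBetti.map (UniversalHypersurface.toProjectiveSpace ℂ n d) 2 (ofRatClass _ 2 θ)) := by
  rw [bettiCohomology.map_comp]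
  change ofRatClass _ 2 (singularCohomology.map ℚ ℚ (AlgPoints.mapContinuous (L := ℂ) (fiberι (family ℂ n d) s)) 2
    (singularCohomology.map ℚ ℚ (AlgPoints.mapContinuous (L := ℂ) (UniversalHypersurface.toProjectiveSpace ℂ n d)) 2 θ)) = _
  rw [ofRatClass_map, ofRatClass_map]

/-- **The top class `θ|ⁿ_{Y_s} = Lⁿ_{θ|_{Y_s}}(1)` is flat**: transport along any path from `s` to `t` carries
`θ|ⁿ_{Y_s} ⊗ 1` to `θ|ⁿ_{Y_t} ⊗ 1` (it is multiplicative, fixes `1`, and carries restrictions of global classes to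
restrictions). Points of the subspace `Set.univ ⊆ U(ℂ)` index the transports. [cite: VoisinHodgeII2003, §3.1.2] -/
theorem transportFun_ofRatClass_topPow (hU : IsCohomologicallyLocallyTrivialOn (family ℂ n d) Set.univ)
    (θ : bettiCohomology (projectiveSpace (n + 1) ℂ) 2) {s t : (Set.univ : Set (ComplexPoints (base ℂ n d)))}
    (γ : Path.Homotopic.Quotient s t) :
    transportFun (family ℂ n d) (n + n) hU γ
        (ofRatClass (ComplexPoints (fiberOver (family ℂ n d) s.1)) (n + n) (lefschetzPowTo
          (bettiCohomology.map (fiberι (family ℂ n d) s.1 ≫ UniversalHypersurface.toProjectiveSpace ℂ n d) 2 θ)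
          n 0 (n + n) (zero_add_two_mul_eq_add_self n) (singularCohomology.one ℚ _))) =
      ofRatClass (ComplexPoints (fiberOver (family ℂ n d) t.1)) (n + n) (lefschetzPowTo
          (bettiCohomology.map (fiberι (family ℂ n d) t.1 ≫ UniversalHypersurface.toProjectiveSpace ℂ n d) 2 θ)
          n 0 (n + n) (zero_add_two_mul_eq_add_self n) (singularCohomology.one ℚ _)) := by
  rw [ofRatClass_lefschetzPowTo, ofRatClass_lefschetzPowTo, ofRatClass_one_flatCoefficient,
    ofRatClass_one_flatCoefficient, ofRatClass_pull_fiberι_toProjectiveSpace,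
    ofRatClass_pull_fiberι_toProjectiveSpace]
  have h := transportFun_lefschetzPowTo (family ℂ n d) hU
    (complexBetti.map (UniversalHypersurface.toProjectiveSpace ℂ n d) 2 (ofRatClass _ 2 θ)) γ n 0 (n + n)
    (zero_add_two_mul_eq_add_self n) (singularCohomology.one ℂ _)
  rw [transportFun_one] at h
  exact h

/-- **The top class `θ|ⁿ_{Y_s}` is non-zero** for `θ ≠ 0`, `n, d ≥ 1`: `Y_s ↪ ℙⁿ⁺¹` is a closed immersion, so `Y_s`
has a Kähler–rational datum with Kähler class `λ · (θ|_{Y_s} ⊗ 1)` (`H²(ℙⁿ⁺¹(ℂ); ℂ) = ℂ θ`), and by hard Lefschetz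
`Lⁿ_{λ θ|} = λⁿ Lⁿ_{θ|}` is injective on `H⁰(Y_s(ℂ); ℂ) ∋ 1 ≠ 0`. [cite: VoisinHodgeI2002, Thm. 6.25 and §7.1.2] -/
theorem topPow_ne_zero (hn : 1 ≤ n) (hd : 1 ≤ d) {θ : bettiCohomology (projectiveSpace (n + 1) ℂ) 2} (hθ : θ ≠ 0)
    (s : ComplexPoints (base ℂ n d)) :
    lefschetzPowTo (bettiCohomology.map (fiberι (family ℂ n d) s ≫ UniversalHypersurface.toProjectiveSpace ℂ n d) 2 θ)
        n 0 (n + n) (zero_add_two_mul_eq_add_self n) (singularCohomology.one ℚ _) ≠ 0 := by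
  have hX : IsSmoothProjective n (fiberOver (family ℂ n d) s) :=
    (isSmoothProjectiveFamily_family ℂ hn hd).isSmoothProjective s
  haveI := UniversalHypersurface.isClosedImmersion_fiberι_toProjectiveSpace_left ℂ n d s
  obtain ⟨D, c, hDc⟩ := exists_kaehlerRationalDatum_eq_map hX
    (fiberι (family ℂ n d) s ≫ UniversalHypersurface.toProjectiveSpace ℂ n d)
  obtain ⟨lam, rfl⟩ := exists_eq_smul_ofRatClass_projectiveSpace_two (n + 1) (by omega) hθ c
  -- the complexified restricted class `h ⊗ 1` and `D.Hη = λ • (h ⊗ 1)`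
  set h := bettiCohomology.map (fiberι (family ℂ n d) s ≫ UniversalHypersurface.toProjectiveSpace ℂ n d) 2 θ
    with hh
  have hH : D.Hη = lam • ofRatClass _ 2 h := by
    rw [hDc, map_smul, hh]
    change _ = lam • ofRatClass _ 2 (singularCohomology.map ℚ ℚ (AlgPoints.mapContinuous (L := ℂ)
      (fiberι (family ℂ n d) s ≫ UniversalHypersurface.toProjectiveSpace ℂ n d)) 2 θ)
    rw [ofRatClass_map]
  -- hard Lefschetz: `Lⁿ_{D.Hη}` is injective on `H⁰`
  have hinj := (bijective_lefschetzPowTo_of_hasHardLefschetz D.Hη (D.hasHardLefschetzProperty hX)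
    (Nat.zero_add n) (n + n) (zero_add_two_mul_eq_add_self n)).1
  -- `1 ≠ 0` in `H⁰(Y_s(ℂ); ℂ)`: otherwise every class vanishes, but `H²ⁿ` is a line
  have hone : singularCohomology.one ℂ (ComplexPoints (fiberOver (family ℂ n d) s)) ≠ 0 := by
    intro h0
    have htop := finrank_complexBetti_two_mul_eq_one hX
    haveI := Module.finite_of_finrank_eq_succ htop
    obtain ⟨v, hv⟩ := Module.finrank_pos_iff_exists_ne_zero.1 (htop ▸ one_pos)
    exact hv (by rw [← cupProduct_one v, h0, map_zero])
  intro hzero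
  have hC : lefschetzPowTo (ofRatClass _ 2 h) n 0 (n + n) (zero_add_two_mul_eq_add_self n)
      (singularCohomology.one ℂ (ComplexPoints (fiberOver (family ℂ n d) s))) = 0 := by
    rw [← ofRatClass_one_flatCoefficient, ← ofRatClass_lefschetzPowTo, hzero, map_zero]
  have hD : lefschetzPowTo D.Hη n 0 (n + n) (zero_add_two_mul_eq_add_self n)
      (singularCohomology.one ℂ (ComplexPoints (fiberOver (family ℂ n d) s))) = 0 := by
    rw [hH, lefschetzPowTo_smul_class, hC, smul_zero]
  exact hone (hinj (by rw [hD, map_zero]))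

/-- **The trace does not vanish on the top class**: `tr_s(θ|ⁿ_{Y_s}) ≠ 0` — `θ|ⁿ_{Y_s} ≠ 0` spans the line
`H²ⁿ(Y_s(ℂ); ℚ)` on which the light trace `tr_s` is a non-zero functional. [cite: VoisinHodgeI2002, §7.1.2] -/
theorem tr_topPow_ne_zero (hn : 1 ≤ n) (hd : 1 ≤ d) {θ : bettiCohomology (projectiveSpace (n + 1) ℂ) 2}
    (hθ : θ ≠ 0) (s : ComplexPoints (base ℂ n d)) :
    BettiUniverse.tr ((isSmoothProjectiveFamily_family ℂ hn hd).isSmoothProjective s) (n + n)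
      (lefschetzPowTo
        (bettiCohomology.map (fiberι (family ℂ n d) s ≫ UniversalHypersurface.toProjectiveSpace ℂ n d) 2 θ)
        n 0 (n + n) (zero_add_two_mul_eq_add_self n) (singularCohomology.one ℚ _)) ≠ 0 := by
  intro htr0
  have hω0 := topPow_ne_zero hn hd hθ s
  have h2 := finrank_rat_top ((isSmoothProjectiveFamily_family ℂ hn hd).isSmoothProjective s)
  have h1 : Module.finrank ℚ (bettiCohomology (fiberOver (family ℂ n d) s) (n + n)) = 1 := by rwa [two_mul] at h2
  haveI := Module.finite_of_finrank_eq_succ h1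
  have htrne : BettiUniverse.tr ((isSmoothProjectiveFamily_family ℂ hn hd).isSmoothProjective s) (n + n) ≠ 0 := by
    rw [show n + n = 2 * n by omega]
    exact BettiUniverse.tr_ne_zero ((isSmoothProjectiveFamily_family ℂ hn hd).isSmoothProjective s) h2
  apply htrne
  apply LinearMap.ext
  intro v
  obtain ⟨q, rfl⟩ := (finrank_eq_one_iff_of_nonzero' _ hω0).1 h1 v
  rw [map_smul, htr0, smul_zero, LinearMap.zero_apply]

/-- **The transport identity.** For a rational transport `T` of `Rⁿ π_* ℚ` along `γ` from `s` to `t`,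
`x, y ∈ Hⁿ(Y_s(ℂ); ℚ)`, `θ ≠ 0` and the top classes `ω_s = θ|ⁿ_{Y_s}`, `ω_t = θ|ⁿ_{Y_t}`:
`tr_t(Tx ∪ Ty) · tr_s(ω_s) = tr_s(x ∪ y) · tr_t(ω_t)` (`x ∪ y = q ω_s` on the line `H²ⁿ(Y_s(ℂ); ℚ)`, transport is
multiplicative and carries `ω_s` to `ω_t`, so `Tx ∪ Ty = q ω_t`). [cite: VoisinHodgeII2003, §3.1.2 and §3.2.3] -/
theorem tr_cup_ratTransport_mul_tr (hn : 1 ≤ n) (hd : 1 ≤ d)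
    (hU : IsCohomologicallyLocallyTrivialOn (family ℂ n d) Set.univ)
    {θ : bettiCohomology (projectiveSpace (n + 1) ℂ) 2} (hθ : θ ≠ 0)
    {s t : (Set.univ : Set (ComplexPoints (base ℂ n d)))} {γ : Path.Homotopic.Quotient s t}
    {T : bettiCohomology (fiberOver (family ℂ n d) s.1) n ≃ₗ[ℚ] bettiCohomology (fiberOver (family ℂ n d) t.1) n}
    (hT : IsRatTransport (family ℂ n d) n hU γ T) (x y : bettiCohomology (fiberOver (family ℂ n d) s.1) n) :
    BettiUniverse.tr ((isSmoothProjectiveFamily_family ℂ hn hd).isSmoothProjective t.1) (n + n)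
        (BettiUniverse.cup (fiberOver (family ℂ n d) t.1) n n (T x) (T y)) *
      BettiUniverse.tr ((isSmoothProjectiveFamily_family ℂ hn hd).isSmoothProjective s.1) (n + n)
        (lefschetzPowTo
          (bettiCohomology.map (fiberι (family ℂ n d) s.1 ≫ UniversalHypersurface.toProjectiveSpace ℂ n d) 2 θ)
          n 0 (n + n) (zero_add_two_mul_eq_add_self n) (singularCohomology.one ℚ _)) =
    BettiUniverse.tr ((isSmoothProjectiveFamily_family ℂ hn hd).isSmoothProjective s.1) (n + n)
        (BettiUniverse.cup (fiberOver (family ℂ n d) s.1) n n x y) *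
      BettiUniverse.tr ((isSmoothProjectiveFamily_family ℂ hn hd).isSmoothProjective t.1) (n + n)
        (lefschetzPowTo
          (bettiCohomology.map (fiberι (family ℂ n d) t.1 ≫ UniversalHypersurface.toProjectiveSpace ℂ n d) 2 θ)
          n 0 (n + n) (zero_add_two_mul_eq_add_self n) (singularCohomology.one ℚ _)) := by
  -- the line `H^{n+n}(Y_s(ℂ); ℚ) = ℚ ω_s`
  have hωs0 := topPow_ne_zero hn hd hθ s.1
  have h1 : Module.finrank ℚ (bettiCohomology (fiberOver (family ℂ n d) s.1) (n + n)) = 1 := by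
    have h2 := finrank_rat_top ((isSmoothProjectiveFamily_family ℂ hn hd).isSmoothProjective s.1)
    rwa [two_mul] at h2
  haveI := Module.finite_of_finrank_eq_succ h1
  obtain ⟨q, hq⟩ := (finrank_eq_one_iff_of_nonzero' _ hωs0).1 h1
    (BettiUniverse.cup (fiberOver (family ℂ n d) s.1) n n x y)
  -- transport: `T x ∪ T y = q ω_t`
  have hcup : BettiUniverse.cup (fiberOver (family ℂ n d) t.1) n n (T x) (T y) = q • lefschetzPowTo
      (bettiCohomology.map (fiberι (family ℂ n d) t.1 ≫ UniversalHypersurface.toProjectiveSpace ℂ n d) 2 θ)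
      n 0 (n + n) (zero_add_two_mul_eq_add_self n) (singularCohomology.one ℚ _) := by
    apply ofRatClass_injective (n + n)
    change ofRatClass _ (n + n) (cupProduct rfl (T x) (T y)) = _
    rw [ofRatClass_cupProduct_flatCoefficient, hT x, hT y, ← transportFun_cupProduct (family ℂ n d) hU rfl γ,
      ← ofRatClass_cupProduct_flatCoefficient]
    change transportFun (family ℂ n d) (n + n) hU γ
      (ofRatClass _ (n + n) (BettiUniverse.cup (fiberOver (family ℂ n d) s.1) n n x y)) = _
    rw [← hq, ofRatClass_smul, transportFun_smul, transportFun_ofRatClass_topPow hU θ γ, ofRatClass_smul]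
  rw [hcup, ← hq, map_smul, map_smul, smul_eq_mul, smul_eq_mul]
  ring

/-- **A flat Picard–Lefschetz coefficient, explicit form.** For every non-zero rational `θ ∈ H²(ℙⁿ⁺¹(ℂ); ℚ)` the
function `c(s) := (tr_s(θ|ⁿ_{Y_s}))⁻¹` is a flat nowhere-zero coefficient of the universal family of smooth
hypersurfaces of degree `d ≥ 1` in `ℙⁿ⁺¹`, `n ≥ 1` (`IsFlatCoefficient`; `tr_topPow_ne_zero` and
`tr_cup_ratTransport_mul_tr`). [cite: VoisinHodgeII2003, §3.1.2 and §3.2.3] [cite: Deligne1974, (5.3)] -/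
theorem isFlatCoefficient_inv_tr_topPow (hn : 1 ≤ n) (hd : 1 ≤ d)
    (hU : IsCohomologicallyLocallyTrivialOn (family ℂ n d) Set.univ)
    {θ : bettiCohomology (projectiveSpace (n + 1) ℂ) 2} (hθ : θ ≠ 0) :
    IsFlatCoefficient n d hn hd hU fun s ↦
      (BettiUniverse.tr ((isSmoothProjectiveFamily_family ℂ hn hd).isSmoothProjective s) (n + n)
        (lefschetzPowTo
          (bettiCohomology.map (fiberι (family ℂ n d) s ≫ UniversalHypersurface.toProjectiveSpace ℂ n d) 2 θ)
          n 0 (n + n) (zero_add_two_mul_eq_add_self n) (singularCohomology.one ℚ _)))⁻¹ := by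
  refine ⟨fun s ↦ inv_ne_zero (tr_topPow_ne_zero hn hd hθ s), ?_⟩
  intro s t γ T hT x y
  have key :
      BettiUniverse.tr ((isSmoothProjectiveFamily_family ℂ hn hd).isSmoothProjective t) (n + n)
          (BettiUniverse.cup (fiberOver (family ℂ n d) t) n n (T x) (T y)) *
        BettiUniverse.tr ((isSmoothProjectiveFamily_family ℂ hn hd).isSmoothProjective s) (n + n)
          (lefschetzPowTo
            (bettiCohomology.map (fiberι (family ℂ n d) s ≫ UniversalHypersurface.toProjectiveSpace ℂ n d) 2 θ)
            n 0 (n + n) (zero_add_two_mul_eq_add_self n) (singularCohomology.one ℚ _)) =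
      BettiUniverse.tr ((isSmoothProjectiveFamily_family ℂ hn hd).isSmoothProjective s) (n + n)
          (BettiUniverse.cup (fiberOver (family ℂ n d) s) n n x y) *
        BettiUniverse.tr ((isSmoothProjectiveFamily_family ℂ hn hd).isSmoothProjective t) (n + n)
          (lefschetzPowTo
            (bettiCohomology.map (fiberι (family ℂ n d) t ≫ UniversalHypersurface.toProjectiveSpace ℂ n d) 2 θ)
            n 0 (n + n) (zero_add_two_mul_eq_add_self n) (singularCohomology.one ℚ _)) :=
    tr_cup_ratTransport_mul_tr hn hd hU hθ (s := toUniv n d s) (t := toUniv n d t) hT x y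
  have hs := tr_topPow_ne_zero hn hd hθ s
  have ht := tr_topPow_ne_zero hn hd hθ t
  rw [inv_mul_eq_div, inv_mul_eq_div, div_eq_div_iff hs ht]
  exact key.symm

/-- **Existence of a flat Picard–Lefschetz coefficient** for the universal family of smooth hypersurfaces of degree
`d ≥ 1` in `ℙⁿ⁺¹_ℂ`, `n ≥ 1`, and every cohomological local trivialisation datum `hU` — conjunct (a) of the named
fact `picardLefschetz_nodalForms_uniform` ("ONE function `c : U(ℂ) → ℚˣ` such that `c(s) · B_s` is FLAT"), PROVED:
the forms `B_s = tr_s ∘ ∪`, rescaled by `c(s) = tr_s(θ|ⁿ_{Y_s})⁻¹`, are carried to one another by every rational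
transport. [cite: VoisinHodgeII2003, §3.1.2 and §3.2.3] [cite: Deligne1974, (5.2.1) and (5.3)] -/
theorem exists_isFlatCoefficient (n d : ℕ) (hn : 1 ≤ n) (hd : 1 ≤ d)
    (hU : IsCohomologicallyLocallyTrivialOn (family ℂ n d) Set.univ) :
    ∃ c : ComplexPoints (base ℂ n d) → ℚ, IsFlatCoefficient n d hn hd hU c := by
  obtain ⟨θ, hθ⟩ := exists_bettiCohomology_projectiveSpace_two_ne_zero (n + 1) (by omega)
  exact ⟨_, isFlatCoefficient_inv_tr_topPow hn hd hU hθ⟩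

/-! ### Elementary closure properties of flat coefficients -/

namespace IsFlatCoefficient

variable {hn : 1 ≤ n} {hd : 1 ≤ d} {hU : IsCohomologicallyLocallyTrivialOn (family ℂ n d) Set.univ}
  {c c' : ComplexPoints (base ℂ n d) → ℚ}

/-- A non-zero constant multiple of a flat coefficient is a flat coefficient (flat coefficients are determined only
up to a global constant). [cite: VoisinHodgeII2003, §3.2.1 Thm. 3.16] -/
theorem const_mul (h : IsFlatCoefficient n d hn hd hU c) {κ : ℚ} (hκ : κ ≠ 0) :
    IsFlatCoefficient n d hn hd hU fun s ↦ κ * c s := by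
  refine ⟨fun s ↦ mul_ne_zero hκ (h.1 s), ?_⟩
  intro s t γ T hT x y
  rw [mul_assoc, mul_assoc, h.2 s t γ T hT x y]

/-- **Two flat coefficients have a transport-invariant ratio**: if `c` and `c'` are flat and `T` is a rational
transport from `s` to `t`, then `c(s) · c'(t) = c(t) · c'(s)` as soon as the form `B_s` takes a non-zero value
at some `(x, y)` (so on a path-connected base they differ by a constant). [cite: VoisinHodgeII2003, §3.2.3] -/
theorem ratio_eq (h : IsFlatCoefficient n d hn hd hU c) (h' : IsFlatCoefficient n d hn hd hU c')
    {s t : ComplexPoints (base ℂ n d)} {γ : Path.Homotopic.Quotient (toUniv n d s) (toUniv n d t)}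
    {T : bettiCohomology (fiberOver (family ℂ n d) s) n ≃ₗ[ℚ] bettiCohomology (fiberOver (family ℂ n d) t) n}
    (hT : IsRatTransport (family ℂ n d) n hU γ T) {x y : bettiCohomology (fiberOver (family ℂ n d) s) n}
    (hxy : BettiUniverse.tr ((isSmoothProjectiveFamily_family ℂ hn hd).isSmoothProjective s) (n + n)
      (BettiUniverse.cup (fiberOver (family ℂ n d) s) n n x y) ≠ 0) :
    c s * c' t = c t * c' s := by
  have e := h.2 s t γ T hT x y
  have e' := h'.2 s t γ T hT x y
  -- eliminate `B_t(Tx, Ty)` between the two flatness relations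
  have key : (c t * c' t) * (c s * c' t - c t * c' s) *
      BettiUniverse.tr ((isSmoothProjectiveFamily_family ℂ hn hd).isSmoothProjective s) (n + n)
        (BettiUniverse.cup (fiberOver (family ℂ n d) s) n n x y) = 0 := by
    linear_combination (c t * c' t) * (c' t * e - c t * e')
  have h0 := (mul_eq_zero.1 ((mul_eq_zero.1 key).resolve_right hxy)).resolve_left (mul_ne_zero (h.1 t) (h'.1 t))
  linear_combination h0

end IsFlatCoefficient

end UniversalFamily

end HodgeTheory

end Literature.AlgebraicGeometry.HodgeTheory

end
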